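/-
Copyright (c) 2026. All rights reserved.
Released under Apache 2.0 license as described in the file LICENSE.
Authors: abc-iut cell, prover seat abc-iut-L4-t5 (gen 10; row «F3757-PORT», abc-iut-L4-lead m147 (5)), after abc-iut-f-101's
`LogFrobeniusMonoTelecoreObservablesShape/Sinks.lean` (the mono-analytic twin), over files 1–4 of this mover.
-/
import Literature.AnabelianGeometry.AbsoluteAnabelian.LogFrobeniusAnTelecoreSinks
import Literature.AnabelianGeometry.AbsoluteAnabelian.DiagramShiftInvariance
import HarnessLib

/-!
# [AbsTopIII] Cor 5.5 (iii), last sentence, inside `D_{An•}`: the four kinds of sinks (`An•[𝒳]`, `ℰ•`, `𝒩⊞_v`, `𝒩_v`)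

S. Mochizuki, *Topics in absolute anabelian geometry III: global reconstruction algorithms*,
J. Math. Sci. Univ. Tokyo 22 (2015) 939–1156 [MochizukiAbsTopIII2015]; manuscript `paper:url-5493eb38cbb7`, locators read on the
page: Cor 5.5 (i) p. 130 (the cores `ℰ•`, `An•[𝒳]`), (ii) p. 130 (`𝔗_{An•}`), (iii) p. 131 (the observables `S_log⊞_v` on
`D•_{≤2} ∪ {𝒩⊞_v}` and `S_log_v` on `(D•_{≤3})_v ∪ {𝒩_v}`, "compatible with one another as well as with the families of homotopies
that constitute the core and telecore structures of (i), (ii)"), Def 3.5 (ii) p. 75, Rmk 3.5.1 p. 78.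

WHAT (row «F3757-PORT», file 5 of the mover; the `D_{An•}` twin of abc-iut-f-101's `LogFrobeniusMonoTelecoreObservablesSinks`).
* the three sub-observable INSTANCES of file 1's `embObs` — `S_log⊞_v` (`plusEmb`), `S_log_v` (`tsEmb`), and the core of (i) at `ℰ•`
  — with their closure facts (`plus_hcl`, `ts_hcl`: no arrow of `D•_{≤5}` enters them from outside; the telecore edges do, from
  `An•[𝒳]`), and the presentations `S_log⊞_v = embPlus^* D_{An•}`, `S_log_v = embTS^* D_{An•}` (`logDiagramPlus_eq_comapAlongAn`,
  `logDiagramTS_eq_comapAlongAn`; families read there: `plusComapAn`, `tsComapAn`);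
* `anSinkAt` — the sink pre-families of `D_{An•}`: ALL pairs into the two core vertices `An•[𝒳]`, `ℰ•` with abc-iut-L4-t5's lifts
  through the fully faithful structure functors `κ_{An•}⁻¹`, `𝟭` (file 1); at `𝒩⊞_v`, `𝒩_v` file 4's inner-or-outer members;
* the three sink laws, dispatched over the four kinds (`an_sink_η_self`, `an_sink_trans`, `an_sink_precomp`); over-ness
  (`an_isOver_sinkη`) follows in file 7.

Pure category theory; nothing here bears on [IUTchIII] Cor. 3.12; no side taken.
-/

set_option autoImplicit false

universe u

open CategoryTheory Quiver

namespace Literature.AnabelianGeometry.AbsoluteAnabelian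

namespace LogFrobeniusSetting

open DiagramOfCategories

variable {Vmod : Type u} {isArc : Vmod → Bool} (L : LogFrobeniusSetting Vmod isArc)

/-! ## The three sub-observable instances -/

section Instances

variable (v : Vmod)

/-- `D•_{≤2} ⊆ D•_{≤5}` (pointwise form for `embObs`). [cite: MochizukiAbsTopIII2015, Cor 5.5 p. 130] -/
theorem inFive_of_inTwo' : ∀ ⦃a : DVertex Vmod isArc⦄, a.InFirstRows 2 → InFive (isArc := isArc) a := fun _ h => inFive_of_inTwo h

/-- `(D•_{≤3})_v ⊆ D•_{≤5}` (pointwise form). [cite: MochizukiAbsTopIII2015, Cor 5.5 p. 130] -/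
theorem inFive_of_inPortionThree' : ∀ ⦃a : DVertex Vmod isArc⦄, InPortionThree v a → InFive (isArc := isArc) a :=
  fun _ h => inFive_of_inPortionThree h

/-- The inclusion `Γ⃗_{D•_{≤2} ∪ {𝒩⊞_v}} ↪ Γ⃗_{D_{An•}}` (file 1's `embObs`; agrees with abc-iut-L4-t3's `embPlus` vertex-by-vertex).
[cite: MochizukiAbsTopIII2015, Cor 5.5 (iii) p. 131] -/
abbrev plusEmb : (logShapePlus (isArc := isArc) v).Vertex ⥤q (anShape (Vmod := Vmod) (isArc := isArc)).Vertex :=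
  embObs (DVertex.InFirstRows 2) (.nplus v) (inFive_of_inTwo' (Vmod := Vmod) (isArc := isArc)) (nplus_mem_five v)

/-- The inclusion `Γ⃗_{(D•_{≤3})_v ∪ {𝒩_v}} ↪ Γ⃗_{D_{An•}}` (agrees with abc-iut-L4-t3's `embTS`). [cite: MochizukiAbsTopIII2015, Cor 5.5 (iii) p. 131] -/
abbrev tsEmb : (logShapeTS (isArc := isArc) v).Vertex ⥤q (anShape (Vmod := Vmod) (isArc := isArc)).Vertex :=
  embObs (InPortionThree v) (.nv v) (inFive_of_inPortionThree' (Vmod := Vmod) (isArc := isArc) v) (nv_mem_five v)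

/-- `𝒩⊞_v ∉ D•_{≤2}`. [cite: MochizukiAbsTopIII2015, Cor 5.5 p. 130] -/
theorem plus_hnot : ¬ (DVertex.nplus v : DVertex Vmod isArc).InFirstRows 2 := fun h => absurd h.2 (by change ¬ (3 ≤ 2); decide)

/-- `𝒩_v ∉ (D•_{≤3})_v`. [cite: MochizukiAbsTopIII2015, Cor 5.5 p. 130] -/
theorem ts_hnot : ¬ InPortionThree (isArc := isArc) v (.nv v) := by
  rintro (h | h)
  · exact absurd h.2 (by change ¬ (4 ≤ 2); decide)
  · cases h

/-- No telecore edge ends at `𝒩⊞_v`. [cite: MochizukiAbsTopIII2015, Cor 5.5 (ii) p. 130] -/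
theorem plus_hxsJ : ∀ j : TelecoreIdx (Vmod := Vmod) (isArc := isArc) (.nplus v), False := fun j => PEmpty.elim j

/-- No telecore edge ends at `𝒩_v`. [cite: MochizukiAbsTopIII2015, Cor 5.5 (ii) p. 130] -/
theorem ts_hxsJ : ∀ j : TelecoreIdx (Vmod := Vmod) (isArc := isArc) (.nv v), False := fun j => PEmpty.elim j

/-- **`D•_{≤2} ∪ {𝒩⊞_v}` is entered by no arrow of `D•_{≤5}`** (only by the telecore edges from `An•[𝒳]`): the source of an arrow
into it lies in `D•_{≤2}`. [cite: MochizukiAbsTopIII2015, Cor 5.5 p. 130] -/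
theorem plus_hcl : ∀ ⦃y : DVertex Vmod isArc⦄ ⦃c : DVertex Vmod isArc⦄, DEdge isArc y c → InFive (isArc := isArc) y →
    (c.InFirstRows 2 ∨ c = .nplus v) → y.InFirstRows 2 := by
  intro y c e _ hc
  cases e with
  | log n => exact row1_mem_two _
  | toCore n => exact row1_mem_two _
  | lam _ _ _ => exact core_mem_two
  | forget w => rcases hc with hc | hc <;> [exact absurd hc.2 (by change ¬ (4 ≤ 2); decide); cases hc]
  | toE w => rcases hc with hc | hc <;> [exact absurd hc.2 (by change ¬ (5 ≤ 2); decide); cases hc]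
  | κAn => rcases hc with hc | hc <;> [exact absurd hc.2 (by change ¬ (6 ≤ 2); decide); cases hc]
  | anToE => rcases hc with hc | hc <;> [exact absurd hc.2 (by change ¬ (7 ≤ 2); decide); cases hc]
  | monoNplus w => rcases hc with hc | hc <;> [exact hc.1.elim; cases hc]
  | monoN w => rcases hc with hc | hc <;> [exact hc.1.elim; cases hc]
  | monoE5 => rcases hc with hc | hc <;> [exact hc.1.elim; cases hc]
  | monoAn => rcases hc with hc | hc <;> [exact hc.1.elim; cases hc]
  | monoE7 => rcases hc with hc | hc <;> [exact hc.1.elim; cases hc]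
  | forgetMono w => rcases hc with hc | hc <;> [exact hc.1.elim; cases hc]
  | toEmono w => rcases hc with hc | hc <;> [exact hc.1.elim; cases hc]
  | κAnMono => rcases hc with hc | hc <;> [exact hc.1.elim; cases hc]
  | anMonoToE => rcases hc with hc | hc <;> [exact hc.1.elim; cases hc]

/-- **`(D•_{≤3})_v ∪ {𝒩_v}` is entered by no arrow of `D•_{≤5}`**. [cite: MochizukiAbsTopIII2015, Cor 5.5 p. 130] -/
theorem ts_hcl : ∀ ⦃y : DVertex Vmod isArc⦄ ⦃c : DVertex Vmod isArc⦄, DEdge isArc y c → InFive (isArc := isArc) y →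
    (InPortionThree v c ∨ c = .nv v) → InPortionThree v y := by
  intro y c e _ hc
  cases e with
  | log n => exact row1_mem_portion v _
  | toCore n => exact row1_mem_portion v _
  | lam _ _ _ => exact core_mem_portion v
  | forget w =>
    rcases hc with (hc | hc) | hc
    · exact absurd hc.2 (by change ¬ (4 ≤ 2); decide)
    · cases hc
    · cases hc; exact nplus_mem_portion v
  | toE w => rcases hc with (hc | hc) | hc <;> [exact absurd hc.2 (by change ¬ (5 ≤ 2); decide); cases hc; cases hc]
  | κAn => rcases hc with (hc | hc) | hc <;> [exact absurd hc.2 (by change ¬ (6 ≤ 2); decide); cases hc; cases hc]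
  | anToE => rcases hc with (hc | hc) | hc <;> [exact absurd hc.2 (by change ¬ (7 ≤ 2); decide); cases hc; cases hc]
  | monoNplus w => rcases hc with (hc | hc) | hc <;> [exact hc.1.elim; cases hc; cases hc]
  | monoN w => rcases hc with (hc | hc) | hc <;> [exact hc.1.elim; cases hc; cases hc]
  | monoE5 => rcases hc with (hc | hc) | hc <;> [exact hc.1.elim; cases hc; cases hc]
  | monoAn => rcases hc with (hc | hc) | hc <;> [exact hc.1.elim; cases hc; cases hc]
  | monoE7 => rcases hc with (hc | hc) | hc <;> [exact hc.1.elim; cases hc; cases hc]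
  | forgetMono w => rcases hc with (hc | hc) | hc <;> [exact hc.1.elim; cases hc; cases hc]
  | toEmono w => rcases hc with (hc | hc) | hc <;> [exact hc.1.elim; cases hc; cases hc]
  | κAnMono => rcases hc with (hc | hc) | hc <;> [exact hc.1.elim; cases hc; cases hc]
  | anMonoToE => rcases hc with (hc | hc) | hc <;> [exact hc.1.elim; cases hc; cases hc]

/-! ### The observables' diagrams ARE `D_{An•}` pulled back along the inclusions -/

/-- ★ `S_log⊞_v`'s diagram is `D_{An•}` pulled back along `plusEmb` (abc-iut-L4-t5's `comapAlong`, via `eq_comapAlong`).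
[cite: MochizukiAbsTopIII2015, Definition 3.5 (i) p.74] -/
theorem logDiagramPlus_eq_comapAlongAn : L.logDiagramPlus v = L.anDiagram.comapAlong (plusEmb (Vmod := Vmod) (isArc := isArc) v) := by
  refine DiagramOfCategories.eq_comapAlong L.anDiagram (plusEmb v) (fun a => ?_) (fun a => ?_) (fun {a b} e => ?_)
  · cases a <;> rfl
  · cases a <;> exact HEq.rfl
  · cases a with
    | base a =>
      cases b with
      | base b => exact HEq.rfl
      | obs => exact HEq.rfl
    | obs =>
      cases b with
      | base b => exact (PEmpty.elim e : False).elim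
      | obs => exact (PEmpty.elim e : False).elim

/-- ★ `S_log_v`'s diagram is `D_{An•}` pulled back along `tsEmb`. [cite: MochizukiAbsTopIII2015, Definition 3.5 (i) p.74] -/
theorem logDiagramTS_eq_comapAlongAn : L.logDiagramTS v = L.anDiagram.comapAlong (tsEmb (Vmod := Vmod) (isArc := isArc) v) := by
  refine DiagramOfCategories.eq_comapAlong L.anDiagram (tsEmb v) (fun a => ?_) (fun a => ?_) (fun {a b} e => ?_)
  · cases a <;> rfl
  · cases a <;> exact HEq.rfl
  · cases a with
    | base a =>
      cases b with
      | base b => exact HEq.rfl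
      | obs => exact HEq.rfl
    | obs =>
      cases b with
      | base b => exact (PEmpty.elim e : False).elim
      | obs => exact (PEmpty.elim e : False).elim

/-- A family of `S_log⊞_v` read on the pulled-back presentation. [cite: MochizukiAbsTopIII2015, Definition 3.5 (ii) p.75] -/
def plusComapAn (H : (L.logDiagramPlus v).HomotopyFamily) :
    (L.anDiagram.comapAlong (plusEmb (Vmod := Vmod) (isArc := isArc) v)).HomotopyFamily :=
  L.logDiagramPlus_eq_comapAlongAn v ▸ H

/-- A family of `S_log_v` read on the pulled-back presentation. [cite: MochizukiAbsTopIII2015, Definition 3.5 (ii) p.75] -/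
def tsComapAn (H : (L.logDiagramTS v).HomotopyFamily) :
    (L.anDiagram.comapAlong (tsEmb (Vmod := Vmod) (isArc := isArc) v)).HomotopyFamily :=
  L.logDiagramTS_eq_comapAlongAn v ▸ H

/-- Same boundary set. [cite: MochizukiAbsTopIII2015, Definition 3.5 (ii) p.75] -/
theorem plusComapAn_E_iff (H : (L.logDiagramPlus v).HomotopyFamily) {a b : (logShapePlus (isArc := isArc) v).Vertex}
    (p q : Path a b) : (L.plusComapAn v H).E p q ↔ H.E p q :=
  DiagramOfCategories.HomotopyFamily.cast_E_iff _ H p q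

/-- Same boundary set. [cite: MochizukiAbsTopIII2015, Definition 3.5 (ii) p.75] -/
theorem tsComapAn_E_iff (H : (L.logDiagramTS v).HomotopyFamily) {a b : (logShapeTS (isArc := isArc) v).Vertex}
    (p q : Path a b) : (L.tsComapAn v H).E p q ↔ H.E p q :=
  DiagramOfCategories.HomotopyFamily.cast_E_iff _ H p q

/-- Same homotopies (heterogeneously). [cite: MochizukiAbsTopIII2015, Definition 3.5 (ii) p.75] -/
theorem plusComapAn_η_heq (H : (L.logDiagramPlus v).HomotopyFamily) {a b : (logShapePlus (isArc := isArc) v).Vertex}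
    {p q : Path a b} (h : (L.plusComapAn v H).E p q) :
    HEq ((L.plusComapAn v H).η h) (H.η ((L.plusComapAn_E_iff v H p q).mp h)) :=
  DiagramOfCategories.HomotopyFamily.cast_η_heq _ H h

/-- Same homotopies (heterogeneously). [cite: MochizukiAbsTopIII2015, Definition 3.5 (ii) p.75] -/
theorem tsComapAn_η_heq (H : (L.logDiagramTS v).HomotopyFamily) {a b : (logShapeTS (isArc := isArc) v).Vertex}
    {p q : Path a b} (h : (L.tsComapAn v H).E p q) :
    HEq ((L.tsComapAn v H).η h) (H.η ((L.tsComapAn_E_iff v H p q).mp h)) :=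
  DiagramOfCategories.HomotopyFamily.cast_η_heq _ H h

/-- **A homotopy of `S_log⊞_v` read inside `D_{An•}`** (on the path functors of `D_{An•}`; abc-iut-f-101's `LiftPair.ofMem … |>.hom`).
[cite: MochizukiAbsTopIII2015, Cor 5.5 (iii) p. 131] -/
noncomputable def embPlusHomAn (H : (L.logDiagramPlus v).HomotopyFamily) {a : (logShapePlus (isArc := isArc) v).Vertex}
    {p q : Path a (logShapePlus (isArc := isArc) v).obs} (h : H.E p q) :
    L.anDiagram.pathFunctor ((plusEmb (Vmod := Vmod) (isArc := isArc) v).mapPath p) ⟶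
      L.anDiagram.pathFunctor ((plusEmb (Vmod := Vmod) (isArc := isArc) v).mapPath q) :=
  (LiftPair.ofMem (F := plusEmb v) (D := L.anDiagram) (K := L.plusComapAn v H) ((L.plusComapAn_E_iff v H p q).mpr h)).hom

/-- **A homotopy of `S_log_v` read inside `D_{An•}`**. [cite: MochizukiAbsTopIII2015, Cor 5.5 (iii) p. 131] -/
noncomputable def embTSHomAn (H : (L.logDiagramTS v).HomotopyFamily) {a : (logShapeTS (isArc := isArc) v).Vertex}
    {p q : Path a (logShapeTS (isArc := isArc) v).obs} (h : H.E p q) :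
    L.anDiagram.pathFunctor ((tsEmb (Vmod := Vmod) (isArc := isArc) v).mapPath p) ⟶
      L.anDiagram.pathFunctor ((tsEmb (Vmod := Vmod) (isArc := isArc) v).mapPath q) :=
  (LiftPair.ofMem (F := tsEmb v) (D := L.anDiagram) (K := L.tsComapAn v H) ((L.tsComapAn_E_iff v H p q).mpr h)).hom

/-- Its components are those of the original homotopy (heterogeneously). [cite: MochizukiAbsTopIII2015, Cor 5.5 (iii) p. 131] -/
theorem embPlusHomAn_app_heq (H : (L.logDiagramPlus v).HomotopyFamily) (x : DSub (DVertex.InFirstRows (isArc := isArc) 2))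
    {p q : Path ((logShapePlus (isArc := isArc) v).base x) (logShapePlus (isArc := isArc) v).obs} (h : H.E p q)
    (X : (L.logDiagramPlus v).obj ((logShapePlus (isArc := isArc) v).base x)) :
    HEq ((L.embPlusHomAn v H h).app X) ((H.η h).app X) := by
  have hD := L.logDiagramPlus_eq_comapAlongAn v
  rw [embPlusHomAn, LiftPair.hom_ofMem]
  simp only [NatTrans.comp_app, eqToHom_app]
  refine (DiagramOfCategories.HomotopyFamily.heq_eqToHom_comp_comp_eqToHom _ _ _).trans ?_
  exact NatTrans.app_heq_of_heq rfl HEq.rfl rfl HEq.rfl (DiagramOfCategories.pathFunctor_heq_of_eq hD p).symm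
    (DiagramOfCategories.pathFunctor_heq_of_eq hD q).symm (L.plusComapAn_η_heq v H _) HEq.rfl

/-- Its components are those of the original homotopy (heterogeneously). [cite: MochizukiAbsTopIII2015, Cor 5.5 (iii) p. 131] -/
theorem embTSHomAn_app_heq (H : (L.logDiagramTS v).HomotopyFamily) (y : DSub (InPortionThree (isArc := isArc) v))
    {p q : Path ((logShapeTS (isArc := isArc) v).base y) (logShapeTS (isArc := isArc) v).obs} (h : H.E p q)
    (X : (L.logDiagramTS v).obj ((logShapeTS (isArc := isArc) v).base y)) :
    HEq ((L.embTSHomAn v H h).app X) ((H.η h).app X) := by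
  have hD := L.logDiagramTS_eq_comapAlongAn v
  rw [embTSHomAn, LiftPair.hom_ofMem]
  simp only [NatTrans.comp_app, eqToHom_app]
  refine (DiagramOfCategories.HomotopyFamily.heq_eqToHom_comp_comp_eqToHom _ _ _).trans ?_
  exact NatTrans.app_heq_of_heq rfl HEq.rfl rfl HEq.rfl (DiagramOfCategories.pathFunctor_heq_of_eq hD p).symm
    (DiagramOfCategories.pathFunctor_heq_of_eq hD q).symm (L.tsComapAn_η_heq v H _) HEq.rfl

end Instances

/-! ## The sinks of `D_{An•}` -/

section AnSinkAt

variable (Hplus : ∀ v : Vmod, (L.logDiagramPlus v).HomotopyFamily) (Hts : ∀ v : Vmod, (L.logDiagramTS v).HomotopyFamily)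

/-- A sink pre-family at one vertex of `D_{An•}` (members and homotopies). [cite: MochizukiAbsTopIII2015, Definition 3.5 (ii) p.75] -/
structure AnSinkAt (n : (anShape (Vmod := Vmod) (isArc := isArc)).Vertex) where
  /-- member pairs into `n` -/
  E : ∀ {a : (anShape (Vmod := Vmod) (isArc := isArc)).Vertex}, Path a n → Path a n → Prop
  /-- their homotopies -/
  η : ∀ {a : (anShape (Vmod := Vmod) (isArc := isArc)).Vertex} {p q : Path a n}, E p q →
    (L.anDiagram.pathFunctor p ⟶ L.anDiagram.pathFunctor q)

/-- At the core vertex `ℰ•` (row 5) the structure functor `𝟭` is fully faithful (any proof of membership in `D•_{≤5}`).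
[cite: MochizukiAbsTopIII2015, Cor 5.5 (i) p. 130] -/
def anOverE_ff_e5' (h : InFive (isArc := isArc) .e5) :
    (L.anOverE.N ((anShape (Vmod := Vmod) (isArc := isArc)).base ⟨.e5, h⟩)).FullyFaithful :=
  Functor.FullyFaithful.id L.E

/-- **The sinks of `D_{An•}`**: at the core vertices `An•[𝒳]` and `ℰ•` ALL pairs, with abc-iut-L4-t5's lifts through the fully
faithful structure functors `κ_{An•}⁻¹`, `𝟭` (the core families of Cor 5.5 (i)); at `𝒩⊞_v` the embedded `S_log⊞_v` closed under the
loops through `An•[𝒳]` (file 4: inner or outer members); at `𝒩_v` likewise for `S_log_v`; nothing elsewhere.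
[cite: MochizukiAbsTopIII2015, Cor 5.5 (iii) p. 131] -/
noncomputable def anSinkAt : ∀ n : (anShape (Vmod := Vmod) (isArc := isArc)).Vertex, L.AnSinkAt n
  | ExtVertex.obs => ⟨fun _ _ => True, fun {_} {p} {q} _ => L.anOverE.lift L.anOverE_ff_obs p q⟩
  | ExtVertex.base ⟨.e5, h⟩ => ⟨fun _ _ => True, fun {_} {p} {q} _ => L.anOverE.lift (L.anOverE_ff_e5' h) p q⟩
  | ExtVertex.base ⟨.nplus v, _⟩ =>
    ⟨fun p q => L.sinkE (DVertex.InFirstRows 2) (.nplus v) inFive_of_inTwo' (nplus_mem_five v) (L.plusComapAn v (Hplus v)) p q,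
      fun h => L.sinkη (DVertex.InFirstRows 2) (.nplus v) inFive_of_inTwo' (nplus_mem_five v) (L.plusComapAn v (Hplus v)) h⟩
  | ExtVertex.base ⟨.nv v, _⟩ =>
    ⟨fun p q => L.sinkE (InPortionThree v) (.nv v) (inFive_of_inPortionThree' v) (nv_mem_five v) (L.tsComapAn v (Hts v)) p q,
      fun h => L.sinkη (InPortionThree v) (.nv v) (inFive_of_inPortionThree' v) (nv_mem_five v) (L.tsComapAn v (Hts v)) h⟩
  | ExtVertex.base ⟨.row1 _, _⟩ => ⟨fun _ _ => False, fun h => h.elim⟩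
  | ExtVertex.base ⟨.core, _⟩ => ⟨fun _ _ => False, fun h => h.elim⟩
  | ExtVertex.base ⟨.an, _⟩ => ⟨fun _ _ => False, fun h => h.elim⟩
  | ExtVertex.base ⟨.e7, _⟩ => ⟨fun _ _ => False, fun h => h.elim⟩
  | ExtVertex.base ⟨.nmonoPlus _, _⟩ => ⟨fun _ _ => False, fun h => h.elim⟩
  | ExtVertex.base ⟨.nmono _, _⟩ => ⟨fun _ _ => False, fun h => h.elim⟩
  | ExtVertex.base ⟨.emono5, _⟩ => ⟨fun _ _ => False, fun h => h.elim⟩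
  | ExtVertex.base ⟨.anMono, _⟩ => ⟨fun _ _ => False, fun h => h.elim⟩
  | ExtVertex.base ⟨.emono7, _⟩ => ⟨fun _ _ => False, fun h => h.elim⟩

/-- The flagged vertices of `D_{An•}`: `An•[𝒳]`, `ℰ•`, `𝒩⊞_v`, `𝒩_v`. [cite: MochizukiAbsTopIII2015, Cor 5.5 (iii) p. 131] -/
def isObsAn : (anShape (Vmod := Vmod) (isArc := isArc)).Vertex → Bool
  | ExtVertex.obs => true
  | ExtVertex.base ⟨.e5, _⟩ => true
  | ExtVertex.base ⟨.nplus _, _⟩ => true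
  | ExtVertex.base ⟨.nv _, _⟩ => true
  | ExtVertex.base _ => false

/-- Members live at flagged vertices only. [cite: MochizukiAbsTopIII2015, Cor 5.5 (iii) p. 131] -/
theorem isObsAn_of_mem {a n : (anShape (Vmod := Vmod) (isArc := isArc)).Vertex} {p q : Path a n}
    (h : (L.anSinkAt Hplus Hts n).E p q) : isObsAn n = true := by
  rcases n with ⟨⟨k⟩ | _ | ⟨w⟩ | ⟨w⟩ | _ | _ | _ | ⟨w⟩ | ⟨w⟩ | _ | _ | _, hx⟩ | _ <;>
    first | rfl | exact (h : False).elim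

/-! ## The sink laws, dispatched -/

/-- `η_self` for the sinks (Def. 3.5 (ii): identity on diagonal members). [cite: MochizukiAbsTopIII2015, Definition 3.5 (ii) p.75] -/
theorem an_sink_η_self {a n : (anShape (Vmod := Vmod) (isArc := isArc)).Vertex} {p : Path a n} (h : (L.anSinkAt Hplus Hts n).E p p) :
    (L.anSinkAt Hplus Hts n).η h = 𝟙 _ := by
  rcases n with ⟨⟨k⟩ | _ | ⟨w⟩ | ⟨w⟩ | _ | _ | _ | ⟨w⟩ | ⟨w⟩ | _ | _ | _, hx⟩ | _ <;>
    first
      | exact (h : False).elim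
      | exact sinkη_self (plus_hnot w) _
      | exact sinkη_self (ts_hnot w) _
      | exact L.anOverE.lift_self _ _

/-- `trans` for the sinks (Def. 3.5 (ii): composition). [cite: MochizukiAbsTopIII2015, Definition 3.5 (ii) p.75] -/
theorem an_sink_trans {a n : (anShape (Vmod := Vmod) (isArc := isArc)).Vertex} {p q r : Path a n}
    (h₁ : (L.anSinkAt Hplus Hts n).E p q) (h₂ : (L.anSinkAt Hplus Hts n).E q r) :
    ∃ h₃ : (L.anSinkAt Hplus Hts n).E p r,
      (L.anSinkAt Hplus Hts n).η h₃ = (L.anSinkAt Hplus Hts n).η h₁ ≫ (L.anSinkAt Hplus Hts n).η h₂ := by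
  rcases n with ⟨⟨k⟩ | _ | ⟨w⟩ | ⟨w⟩ | _ | _ | _ | ⟨w⟩ | ⟨w⟩ | _ | _ | _, hx⟩ | _
  · exact (h₁ : False).elim
  · exact (h₁ : False).elim
  · exact anSink_trans (plus_hnot w) h₁ h₂
  · exact anSink_trans (ts_hnot w) h₁ h₂
  · exact ⟨trivial, (L.anOverE.lift_trans _ p q r).symm⟩
  · exact (h₁ : False).elim
  · exact (h₁ : False).elim
  · exact (h₁ : False).elim
  · exact (h₁ : False).elim
  · exact (h₁ : False).elim
  · exact (h₁ : False).elim
  · exact (h₁ : False).elim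
  · exact ⟨trivial, (L.anOverE.lift_trans _ p q r).symm⟩

set_option backward.defeqAttrib.useBackward true in
/-- Components of a transformation heterogeneously equal to a left whiskering (bookkeeping for Def 3.5 (ii)).
[cite: MochizukiAbsTopIII2015, Definition 3.5 (ii) p.75] -/
theorem app_eq_of_heq_whiskerLeft' {A B C : Type*} [Category A] [Category B] [Category C] {R : A ⥤ B}
    {P Q : B ⥤ C} {P' Q' : A ⥤ C} (eP : P' = R ⋙ P) (eQ : Q' = R ⋙ Q) {θ' : P' ⟶ Q'} {θ : P ⟶ Q}
    (h : HEq θ' (Functor.whiskerLeft R θ)) (x : A) (h₁ : P'.obj x = P.obj (R.obj x)) (h₂ : Q.obj (R.obj x) = Q'.obj x) :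
    θ'.app x = eqToHom h₁ ≫ θ.app (R.obj x) ≫ eqToHom h₂ := by
  subst eP eQ
  cases h
  exact (eq_of_heq (DiagramOfCategories.HomotopyFamily.heq_eqToHom_comp_comp_eqToHom h₁ h₂ _)).symm

/-- `precomp` for the sinks (Def. 3.5 (ii): pre-whiskering by any path of `D_{An•}`). [cite: MochizukiAbsTopIII2015, Definition 3.5 (ii) p.75] -/
theorem an_sink_precomp {c a n : (anShape (Vmod := Vmod) (isArc := isArc)).Vertex} {p q : Path a n}
    (h : (L.anSinkAt Hplus Hts n).E p q) (r : Path c a) :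
    ∃ h' : (L.anSinkAt Hplus Hts n).E (r.comp p) (r.comp q), ∀ x : L.anDiagram.obj c,
      ((L.anSinkAt Hplus Hts n).η h').app x = eqToHom (L.anDiagram.pathFunctor_comp_obj r p x) ≫
        ((L.anSinkAt Hplus Hts n).η h).app ((L.anDiagram.pathFunctor r).obj x) ≫
          eqToHom (L.anDiagram.pathFunctor_comp_obj r q x).symm := by
  rcases n with ⟨⟨k⟩ | _ | ⟨w⟩ | ⟨w⟩ | _ | _ | _ | ⟨w⟩ | ⟨w⟩ | _ | _ | _, hx⟩ | _
  · exact (h : False).elim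
  · exact (h : False).elim
  · exact anSink_precomp (plus_hcl w) (plus_hxsJ w) (plus_hnot w) h r
  · exact anSink_precomp (ts_hcl w) (ts_hxsJ w) (ts_hnot w) h r
  · exact ⟨trivial, fun x => app_eq_of_heq_whiskerLeft' (L.anDiagram.pathFunctor_comp r p) (L.anDiagram.pathFunctor_comp r q)
      (L.anOverE.lift_precomp_heq _ r p q) x _ _⟩
  · exact (h : False).elim
  · exact (h : False).elim
  · exact (h : False).elim
  · exact (h : False).elim
  · exact (h : False).elim
  · exact (h : False).elim
  · exact (h : False).elim
  · exact ⟨trivial, fun x => app_eq_of_heq_whiskerLeft' (L.anDiagram.pathFunctor_comp r p) (L.anDiagram.pathFunctor_comp r q)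
      (L.anOverE.lift_precomp_heq _ r p q) x _ _⟩

end AnSinkAt

end LogFrobeniusSetting

end Literature.AnabelianGeometry.AbsoluteAnabelian
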